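import Summits.BirchSwinnertonDyer.BirchSwinnertonDyer.Theses.SchneiderFreeAdditiveX3
import Summits.BirchSwinnertonDyer.BirchSwinnertonDyer.Theorems.SchneiderFreeControlAtoms
import Summits.BirchSwinnertonDyer.BirchSwinnertonDyer.Theorems.SchneiderFreeAdditiveX3AnticycControlAdditiveStubNoLocalPTorsionOfAtoms
import Summits.BirchSwinnertonDyer.Rank1Residual.X11b.BDPRouteControlStrictPlace
import Summits.BirchSwinnertonDyer.Rank1Residual.X11b.AnticyclotomicControlSplitImprimitive
import Summits.BirchSwinnertonDyer.Rank1Residual.X11b.CoinvariantsDescent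
import HarnessLib

/-!
# Crux `AnticycControlAdditive` (route `SchneiderFreeAdditiveX3`, item stmt-BirchSwinnertonDyer-19178):
# the TORSION-ROBUST control count — the kernel glue for the `t_p = 1` stub

Seat `bsd-schneider-door-c4` (cell `bsd-schneider-ideate`). On the `t_p = 1` half of the crux
(`E(K_𝔭)[p] ≠ 0`: 57.9 % of B6's pairs — all of `(p, e) = (3, 2)` with `E(ℚ_3)[3] ≠ 0`, III@5, II@7)
the control map `s : Sel_𝔭(K, E[p^∞]) → Sel_𝔭(K_∞, E[p^∞])^Γ` is NEITHER injective (`E(K)[p] ≠ 0`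
is possible on X3) NOR surjective (the strict place contributes `ker r_𝔭 ≠ 0`), so the tree's
bijection-based passage (`natCard_endInvariants_empty_eq_mul_prod`, used by the BC5 rung
`additiveControlOnTreeAt_of_atoms`) does not apply. This file proves the replacement, an EXACT
count with both defects carried as cardinalities of tree objects:

* `mem_selmerAcPreimage_of_loc` — a class of `H¹(K, E[p^∞])` whose localisations at a finite set
  `T ∋ 𝔭` lie in Greenberg's local kernels `ker r_v` and which is locally trivial at the finite
  `v ∉ Σ ∪ T ∪ {w ∣ p}` lies in `A = res⁻¹(Sel_𝔭^Σ(K_∞, E[p^∞]))` (totally complex `K`).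
* **`natCard_endInvariants_mul_natCard_resKer_eq`** — for `E` over a totally complex `K`, `κ` with
  topological generator `γ`, `𝔭`, `Σ`, a finite `T ∋ 𝔭` (other members `∤ p`, `∉ Σ`) outside which
  the away conditions descend: IF the localisation `H¹(K, E[p^∞]) → ∏_{v∈T} H¹(K_v, E[p^∞])` reaches
  every element of `∏_{v∈T} ker r_v` by a class locally trivial off `Σ ∪ T ∪ {w ∣ p}` (Poitou–Tate,
  JSW17 Prop. 3.3.2 for CASTELLA's structure — an input, element form), THEN
  `#Sel_𝔭^Σ(K_∞, E[p^∞])^γ · #ker(H¹(K, E[p^∞]) → H¹(K_∞, E[p^∞])) = #Sel_𝔭^Σ(K, E[p^∞]) · ∏_{v∈T} #ker r_v`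
  (all four groups finite). Greenberg §3 / JSW §3.3.4 snake lemma with `ker h ≠ 0` and `ker r_𝔭 ≠ 0`
  both COUNTED (Keller–Yin arXiv:2402.12781 App. B, Thm. B.0.6, is the printed template at a
  semistable prime: `C^Σ(W)/(#H⁰(K,W))²`).
* `natCard_endInvariants_mul_natCard_resKer_eq_nPlus` — the same for `K` imaginary quadratic, `κ`
  ANTICYCLOTOMIC, `Σ = ∅`, `T = {𝔭} ∪ Σ(N⁺)`: away descent discharged by the tree
  (`away_descent_of_splitBad_subset`).
* Companion file `…AnticycControlAdditiveOfTorsAtoms.lean`: T-B6-2′ and the crux BY NAME from this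
  count plus the torsion-aware base count (P6-add-tors), (L10), (P11) — the exponents `g`
  (`p^g = #ker res`) and `t` (`p^t = #ker r_𝔭`) CANCEL.

CONDITIONAL on the atoms (hypotheses on cardinalities of tree objects; no `Prop` fact is minted);
closes nothing by itself; BSD is not proved by any of this. Derivation memo: evidence
`CONTROL-DERIVATION.md` on the crux item.

References: [JetchevSkinnerWan2017] §3.2–3.3 (arXiv:1512.06894 pp. 10–14); [GreenbergLNM1716] §3
pp. 85–90; [Castella2018] Thm. 2.3; Keller–Yin arXiv:2402.12781 App. B (Thm. B.0.6).
-/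

noncomputable section

open scoped Classical

open WeierstrassCurve NumberField IsDedekindDomain Field Literature.NumberTheory.EllipticCurves
  Literature.NumberTheory.EllipticCurves.ModularForms
  Literature.NumberTheory.EllipticCurves.GreenbergSelmer
  Literature.NumberTheory.GaloisRepresentations
  Literature.NumberTheory.EllipticCurves.Rank1Residual
  Literature.NumberTheory.EllipticCurves.Rank1Residual.Typed
  Summit.BirchSwinnertonDyer.Rank1Residual
  Summit.BirchSwinnertonDyer.Rank1Residual.X11b
  Summit.BirchSwinnertonDyer.Rank1Residual.X11b.AcSelmer
  Summit.BirchSwinnertonDyer.BirchSwinnertonDyer.Theorems.SchneiderFree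
  Summit.BirchSwinnertonDyer.BirchSwinnertonDyer.Theorems.SchneiderFreeControlAtoms

set_option linter.dupNamespace false

namespace Summit.BirchSwinnertonDyer.BirchSwinnertonDyer.Theorems.SchneiderFreeAdditiveX3

/-! ## Classes with prescribed local kernels lie in `A = res⁻¹(Sel_𝔭^Σ(K_∞, E[p^∞]))` -/

section Preimage

variable {K : Type} [Field K] [NumberField K]
variable {W : WeierstrassCurve K} {p : ℕ} [Fact p.Prime] {κ : ZpExtension K p}
  {𝔭 : HeightOneSpectrum (𝓞 K)} {S : Set (HeightOneSpectrum (𝓞 K))}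

/-- **A class with localisations in the local kernels lies in `A`.** For totally complex `K`, a finite
`T ∋ 𝔭` disjoint from `Σ`: if `c ∈ H¹(K, E[p^∞])` has `loc_v c ∈ ker r_v` for every `v ∈ T` and is
locally trivial at every finite `v ∤ p`, `v ∉ Σ ∪ T`, then `res_{K→K_∞} c ∈ Sel_𝔭^Σ(K_∞, E[p^∞])`
(the conjugates of a restricted class are itself; the strict condition at `𝔭` over `K_∞` is local
triviality, i.e. `loc_𝔭 c ∈ ker r_𝔭`; complex places impose nothing).
[cite: GreenbergLNM1716, §3 pp. 85–86] [cite: Castella2018, Def. 2.2 (arXiv:1704.06608 p. 5)] -/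
theorem mem_selmerAcPreimage_of_loc [IsTotallyComplex K] {T : Finset (HeightOneSpectrum (𝓞 K))}
    (h𝔭T : 𝔭 ∈ T) {c : W.subgroupH1 p (⊤ : Subgroup (absoluteGaloisGroup K))}
    (hcT : ∀ v : T, locAtFinset W p T c v ∈
      localKer κ.kerSubgroup (W.geomPrimaryTorsion p) (v : HeightOneSpectrum (𝓞 K)))
    (hcS : ∀ v : HeightOneSpectrum (𝓞 K), ((p : ℕ) : 𝓞 K) ∉ v.asIdeal → v ∉ S → v ∉ T →
      c ∈ awayKer ⊤ (W.geomPrimaryTorsion p) v) :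
    c ∈ selmerAcPreimage W p κ 𝔭 S := by
  rw [mem_selmerAcPreimage_iff]
  have hconj : ∀ σ : absoluteGaloisGroup K,
      conjH1 κ.kerSubgroup (W.geomPrimaryTorsion p) σ
          (resOfLe (W.geomPrimaryTorsion p) (le_top : κ.kerSubgroup ≤ ⊤) c) =
        resOfLe (W.geomPrimaryTorsion p) (le_top : κ.kerSubgroup ≤ ⊤) c :=
    fun σ ↦ conjH1_resOfLe_top σ c
  refine (mem_selmerOver_iff_awayKer κ.kerSubgroup (W.geomPrimaryTorsion p) _).mpr
    ⟨fun v hv hvS σ ↦ ?_, fun w σ ↦ ?_, fun σ ↦ ?_⟩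
  · rw [hconj]
    by_cases hvT : v ∈ T
    · have h := hcT ⟨v, hvT⟩
      rw [locAtFinset_apply] at h
      exact (resOfLe_mem_localKer_iff v c).mp h
    · exact resOfLe_mem_awayKer le_top v (hcS v hv hvS hvT)
  · rw [hconj]
    exact Coinv.mem_infKer_of_decompInf_eq_bot w
      (decompInf_eq_bot_of_isComplex (IsTotallyComplex.isComplex w)) _
  · rw [hconj]
    have h := hcT ⟨𝔭, h𝔭T⟩
    rw [locAtFinset_apply] at h
    exact (resOfLe_mem_localKer_iff 𝔭 c).mp h

end Preimage

/-! ## The torsion-robust counting snake lemma (EXACT form) -/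

section Count

variable {K : Type} [Field K] [NumberField K]
variable {W : WeierstrassCurve K} {p : ℕ} [Fact p.Prime] {κ : ZpExtension K p}
  {𝔭 : HeightOneSpectrum (𝓞 K)} {S : Set (HeightOneSpectrum (𝓞 K))}

/-- **The counting snake lemma with kernel AND cokernel defects, exact (Greenberg §3 / JSW §3.3.4 /
Keller–Yin App. B).** For `E` over a totally complex `K`, `κ` with topological generator `γ`, `𝔭`, `Σ`,
a finite `T ∋ 𝔭` (other members `∤ p`, `∉ Σ`) outside which the away conditions descend, with
`Sel_𝔭^Σ(K, E[p^∞])` and the `ker r_v` (`v ∈ T`) finite: IF every element of `∏_{v∈T} ker r_v` is the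
localisation of a class of `H¹(K, E[p^∞])` locally trivial at the finite `v ∤ p` off `Σ ∪ T`
(`hloc` — Poitou–Tate surjectivity for Castella's structure, JSW17 Prop. 3.3.2 shape, an INPUT),
THEN `Sel_𝔭^Σ(K_∞, E[p^∞])^γ` and `ker(H¹(K, E[p^∞]) → H¹(K_∞, E[p^∞]))` are finite and
`#Sel^γ · #ker res = #Sel_𝔭^Σ(K, E[p^∞]) · ∏_{v∈T} #ker r_v`.
Proof: `A = res⁻¹(Sel^Σ(K_∞))` maps ONTO `Sel^γ` (Lemma 3.2, tree) with kernel `ker res ⊆ A`, and the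
localisation `ψ : A → ∏_{v∈T} H¹(K_v)` has kernel `Sel^Σ(K)` and image exactly `∏ ker r_v`.
[cite: GreenbergLNM1716, §3 pp. 85–86 and p. 90] [cite: JetchevSkinnerWan2017, §3.3.4 (arXiv:1512.06894 pp. 13–14)] -/
theorem natCard_endInvariants_mul_natCard_resKer_eq [IsTotallyComplex K]
    {γ : absoluteGaloisGroup K} (hγ : κ.IsTopGenerator γ)
    (T : Finset (HeightOneSpectrum (𝓞 K))) (h𝔭T : 𝔭 ∈ T)
    (hTp : ∀ v ∈ T, v ≠ 𝔭 → ((p : ℕ) : 𝓞 K) ∉ v.asIdeal) (hTS : ∀ v ∈ T, v ∉ S)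
    (hS : ∀ c : W.subgroupH1 p (⊤ : Subgroup (absoluteGaloisGroup K)),
      W.resOfLe p (le_top : κ.kerSubgroup ≤ ⊤) c ∈ selmerAc W p κ 𝔭 S →
        ∀ v : HeightOneSpectrum (𝓞 K), ((p : ℕ) : 𝓞 K) ∉ v.asIdeal → v ∉ S → v ∉ T →
          c ∈ awayKer ⊤ (W.geomPrimaryTorsion p) v)
    [Finite (selmerAcBase W p 𝔭 S)]
    (hfin : ∀ v ∈ T, Finite (localKer κ.kerSubgroup (W.geomPrimaryTorsion p) v))
    (hloc : ∀ x : Π v : T, Literature.NumberTheory.EllipticCurves.subgroupH1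
        ((⊤ : Subgroup (absoluteGaloisGroup K)) ⊓ decomp (v : HeightOneSpectrum (𝓞 K)))
        (W.geomPrimaryTorsion p),
      (∀ v : T, x v ∈ localKer κ.kerSubgroup (W.geomPrimaryTorsion p) (v : HeightOneSpectrum (𝓞 K))) →
        ∃ c : W.subgroupH1 p (⊤ : Subgroup (absoluteGaloisGroup K)), locAtFinset W p T c = x ∧
          ∀ v : HeightOneSpectrum (𝓞 K), ((p : ℕ) : 𝓞 K) ∉ v.asIdeal → v ∉ S → v ∉ T →
            c ∈ awayKer ⊤ (W.geomPrimaryTorsion p) v) :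
    Finite (IwasawaDual.endInvariants (conjSelmerAc W p κ 𝔭 S γ - 1)) ∧
      Finite (W.resOfLe p (le_top : κ.kerSubgroup ≤ ⊤)).ker ∧
      Nat.card (IwasawaDual.endInvariants (conjSelmerAc W p κ 𝔭 S γ - 1)) *
          Nat.card (W.resOfLe p (le_top : κ.kerSubgroup ≤ ⊤)).ker =
        Nat.card (selmerAcBase W p 𝔭 S) *
          ∏ v ∈ T, Nat.card (localKer κ.kerSubgroup (W.geomPrimaryTorsion p) v) := by
  set A := selmerAcPreimage W p κ 𝔭 S
  -- the localisation restricted to `A`; (1) its image lies in `∏ ker r_v`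
  set ψ : A →+ Π v : T, Literature.NumberTheory.EllipticCurves.subgroupH1
      ((⊤ : Subgroup (absoluteGaloisGroup K)) ⊓ decomp (v : HeightOneSpectrum (𝓞 K)))
      (W.geomPrimaryTorsion p) :=
    (locAtFinset W p T).comp A.subtype
  have hψ : ∀ a : A, ψ a = locAtFinset W p T (a : W.subgroupH1 p ⊤) := fun a ↦ rfl
  have hrange : ∀ (a : A) (v : T), ψ a v ∈ localKer κ.kerSubgroup (W.geomPrimaryTorsion p) v :=
    fun a v ↦ resOfLe_mem_localKer_of_mem_selmerAcPreimage_strict hTp hTS a.2 v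
  -- (2) the kernel is `Sel_𝔭^Σ(K, E[p^∞])`
  have hker : ∀ a : A, a ∈ ψ.ker ↔ (a : W.subgroupH1 p ⊤) ∈ selmerAcBase W p 𝔭 S := by
    intro a
    rw [AddMonoidHom.mem_ker, mem_selmerAcBase_iff_locAtFinset_eq_zero_strict h𝔭T hTp hTS hS a.2]
    rfl
  -- (3) `im ψ ≃ ∏ ker r_v` (onto by `hloc`)
  haveI hfinT : ∀ v : T, Finite (localKer κ.kerSubgroup (W.geomPrimaryTorsion p)
      (v : HeightOneSpectrum (𝓞 K))) := fun v ↦ hfin v v.2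
  let e : ψ.range → Π v : T, localKer κ.kerSubgroup (W.geomPrimaryTorsion p)
      (v : HeightOneSpectrum (𝓞 K)) :=
    fun y ↦ fun v ↦ ⟨y.1 v, by
      obtain ⟨a, ha⟩ := y.2
      rw [← ha]
      exact hrange a v⟩
  have he : Function.Injective e := by
    intro y₁ y₂ h
    apply Subtype.ext
    funext v
    simpa [e] using congrArg Subtype.val (congr_fun h v)
  have hes : Function.Surjective e := by
    intro y
    obtain ⟨c, hcx, hcS⟩ := hloc (fun v ↦ (y v : _)) (fun v ↦ (y v).2)
    have hcA : c ∈ A :=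
      mem_selmerAcPreimage_of_loc h𝔭T (fun v ↦ by rw [hcx]; exact (y v).2) hcS
    refine ⟨⟨ψ ⟨c, hcA⟩, ⟨⟨c, hcA⟩, rfl⟩⟩, ?_⟩
    funext v
    apply Subtype.ext
    show ψ ⟨c, hcA⟩ v = (y v : _)
    rw [hψ, hcx]
  have hcard_range : Nat.card ψ.range =
      ∏ v ∈ T, Nat.card (localKer κ.kerSubgroup (W.geomPrimaryTorsion p) v) := by
    rw [Nat.card_congr (Equiv.ofBijective e ⟨he, hes⟩), Nat.card_pi]
    exact Finset.prod_coe_sort T fun v ↦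
      Nat.card (localKer κ.kerSubgroup (W.geomPrimaryTorsion p) v)
  haveI : Finite ψ.range := Finite.of_injective e he
  -- (4) `ker ψ ≃ Sel_𝔭^Σ(K, E[p^∞])`
  let f : ψ.ker → selmerAcBase W p 𝔭 S := fun a ↦ ⟨((a : A) : W.subgroupH1 p ⊤), (hker a).mp a.2⟩
  have hf : Function.Injective f := by
    intro a₁ a₂ h
    apply Subtype.ext; apply Subtype.ext
    simpa [f] using congrArg (fun x : selmerAcBase W p 𝔭 S ↦ (x : W.subgroupH1 p ⊤)) h
  have hfs : Function.Surjective f := by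
    intro b
    refine ⟨⟨⟨(b : W.subgroupH1 p ⊤), selmerAcBase_le_selmerAcPreimage b.2⟩, (hker _).mpr b.2⟩, ?_⟩
    exact Subtype.ext rfl
  have hcard_ker : Nat.card ψ.ker = Nat.card (selmerAcBase W p 𝔭 S) :=
    Nat.card_congr (Equiv.ofBijective f ⟨hf, hfs⟩)
  haveI : Finite ψ.ker := Finite.of_injective f hf
  -- (5) `A` is finite and `#A = #Sel(K) · ∏ #ker r_v`
  haveI : Finite (A ⧸ ψ.ker) :=
    Finite.of_equiv _ (QuotientAddGroup.quotientKerEquivRange ψ).toEquiv.symm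
  haveI hAfin : Finite A :=
    Finite.of_equiv _ (AddSubgroup.addGroupEquivQuotientProdAddSubgroup (s := ψ.ker)).symm
  have hcardA : Nat.card A = Nat.card (selmerAcBase W p 𝔭 S) *
      ∏ v ∈ T, Nat.card (localKer κ.kerSubgroup (W.geomPrimaryTorsion p) v) := by
    rw [AddSubgroup.card_eq_card_quotient_mul_card_addSubgroup ψ.ker,
      Nat.card_congr (QuotientAddGroup.quotientKerEquivRange ψ).toEquiv, mul_comm, hcard_ker,
      hcard_range]
  -- (6) `res : A ↠ Sel^γ` with kernel `ker res`
  let g : A →+ IwasawaDual.endInvariants (conjSelmerAc W p κ 𝔭 S γ - 1) :=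
    { toFun := fun a ↦
        ⟨⟨W.resOfLe p (le_top : κ.kerSubgroup ≤ ⊤) (a : W.subgroupH1 p ⊤),
            (mem_selmerAcPreimage_iff _).mp a.2⟩, by
          rw [IwasawaDual.mem_endInvariants_iff, IwasawaDual.End_sub_apply, AddMonoid.End.one_apply,
            sub_eq_zero]
          exact Subtype.ext (conjH1_resOfLe_top γ (a : W.subgroupH1 p ⊤))⟩
      map_zero' := Subtype.ext (Subtype.ext (by simp))
      map_add' := fun a b ↦ Subtype.ext (Subtype.ext (by simp)) }
  have hgval : ∀ a : A, (((g a : IwasawaDual.endInvariants (conjSelmerAc W p κ 𝔭 S γ - 1)) :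
      selmerAc W p κ 𝔭 S) : W.subgroupH1 p κ.kerSubgroup) =
        W.resOfLe p (le_top : κ.kerSubgroup ≤ ⊤) (a : W.subgroupH1 p ⊤) := fun a ↦ rfl
  have hg : Function.Surjective g := by
    intro x
    obtain ⟨c, hcA, hc⟩ := exists_mem_selmerAcPreimage_resOfLe_eq hγ x
    exact ⟨⟨c, hcA⟩, Subtype.ext (Subtype.ext hc)⟩
  -- `ker g ≃ ker res`
  have hgker : ∀ a : A, a ∈ g.ker ↔
      (a : W.subgroupH1 p ⊤) ∈ (W.resOfLe p (le_top : κ.kerSubgroup ≤ ⊤)).ker := by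
    intro a
    rw [AddMonoidHom.mem_ker, AddMonoidHom.mem_ker, ← hgval a]
    constructor
    · intro h; rw [h]; rfl
    · intro h; exact Subtype.ext (Subtype.ext h)
  let k : g.ker → (W.resOfLe p (le_top : κ.kerSubgroup ≤ ⊤)).ker :=
    fun a ↦ ⟨((a : A) : W.subgroupH1 p ⊤), (hgker a).mp a.2⟩
  have hk : Function.Injective k := by
    intro a₁ a₂ h
    apply Subtype.ext; apply Subtype.ext
    simpa [k] using congrArg
      (fun x : (W.resOfLe p (le_top : κ.kerSubgroup ≤ ⊤)).ker ↦ (x : W.subgroupH1 p ⊤)) h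
  have hks : Function.Surjective k := by
    intro c
    have hc0 : W.resOfLe p (le_top : κ.kerSubgroup ≤ ⊤) (c : W.subgroupH1 p ⊤) = 0 :=
      (AddMonoidHom.mem_ker).mp c.2
    have hcA : (c : W.subgroupH1 p ⊤) ∈ A := by
      rw [mem_selmerAcPreimage_iff, hc0]
      exact zero_mem _
    exact ⟨⟨⟨(c : W.subgroupH1 p ⊤), hcA⟩, (hgker _).mpr c.2⟩, Subtype.ext rfl⟩
  have hcard_gker : Nat.card g.ker = Nat.card (W.resOfLe p (le_top : κ.kerSubgroup ≤ ⊤)).ker :=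
    Nat.card_congr (Equiv.ofBijective k ⟨hk, hks⟩)
  have hcardA' : Nat.card A =
      Nat.card (IwasawaDual.endInvariants (conjSelmerAc W p κ 𝔭 S γ - 1)) *
        Nat.card (W.resOfLe p (le_top : κ.kerSubgroup ≤ ⊤)).ker := by
    rw [AddSubgroup.card_eq_card_quotient_mul_card_addSubgroup g.ker,
      Nat.card_congr (QuotientAddGroup.quotientKerEquivOfSurjective g hg).toEquiv, hcard_gker]
  refine ⟨Finite.of_surjective g hg, ?_, ?_⟩
  · haveI : Finite g.ker := inferInstance
    exact Finite.of_equiv _ (Equiv.ofBijective k ⟨hk, hks⟩)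
  · rw [← hcardA', hcardA]

end Count

/-! ## `K` imaginary quadratic, `κ` anticyclotomic, `Σ = ∅`, `T = {𝔭} ∪ Σ(N⁺)` -/

section Anticyclotomic

variable {W : WeierstrassCurve ℚ} [W.IsElliptic] [W.IsGloballyMinimal] {K : Type} [Field K]
  [NumberField K] {p : ℕ} [Fact p.Prime] {κ : ZpExtension K p}

omit [W.IsGloballyMinimal] [Fact p.Prime] in
/-- `𝔭 ∣ p` is not in `Σ(N⁺)` (whose members are away from `p`). [folklore] -/
theorem not_mem_nPlusPlaces_toFinset_of_mem (hK : IsImaginaryQuadratic K)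
    {𝔭 : HeightOneSpectrum (𝓞 K)} (h𝔭 : ((p : ℕ) : 𝓞 K) ∈ 𝔭.asIdeal) :
    𝔭 ∉ (nPlusPlaces_finite (W := W) (p := p) (K := K) hK.1).toFinset := fun h ↦
  ((mem_nPlusPlaces_iff 𝔭).mp ((nPlusPlaces_finite (W := W) (p := p) hK.1).mem_toFinset.mp h)).1 h𝔭

omit [W.IsGloballyMinimal] in
/-- **The torsion-robust count for Castella's Selmer group of `E/ℚ` over an imaginary quadratic `K`
along the ANTICYCLOTOMIC tower** (`Σ = ∅`, `T = {𝔭} ∪ Σ(N⁺)`; away descent off `T` is the tree's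
`away_descent_of_splitBad_subset`: good places, inert and ramified places):
`#Sel_𝔭(K_∞, E[p^∞])^γ · #ker res = #Sel_𝔭(K, E[p^∞]) · #ker r_𝔭 · ∏_{w ∈ Σ(N⁺)} #ker r_w`, GIVEN the
Poitou–Tate surjectivity `hloc` (JSW17 Prop. 3.3.2 shape for Castella's structure; an INPUT).
NO hypothesis on `E(K_𝔭)[p]` or `E(K)[p]`.
[cite: JetchevSkinnerWan2017, §3.3.4 (arXiv:1512.06894 pp. 13–14)] [cite: GreenbergLNM1716, §3 p. 90] -/
theorem natCard_endInvariants_mul_natCard_resKer_eq_nPlus (hK : IsImaginaryQuadratic K)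
    (hκ : κ.IsAnticyclotomic) (γ : absoluteGaloisGroup K) [hγ : Fact (κ.IsTopGenerator γ)]
    (𝔭 : HeightOneSpectrum (𝓞 K)) (h𝔭 : ((p : ℕ) : 𝓞 K) ∈ 𝔭.asIdeal)
    [Finite (selmerAcBase (W.baseChange K) p 𝔭 ∅)]
    (hfin𝔭 : Finite (localKer κ.kerSubgroup ((W.baseChange K).geomPrimaryTorsion p) 𝔭))
    (hfin : ∀ v ∈ nPlusPlaces W K p,
      Finite (localKer κ.kerSubgroup ((W.baseChange K).geomPrimaryTorsion p) v))
    (hloc : ∀ x : Π v : ↥(insert 𝔭 (nPlusPlaces_finite (W := W) (p := p) (K := K) hK.1).toFinset),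
        Literature.NumberTheory.EllipticCurves.subgroupH1
          ((⊤ : Subgroup (absoluteGaloisGroup K)) ⊓ decomp (v : HeightOneSpectrum (𝓞 K)))
          ((W.baseChange K).geomPrimaryTorsion p),
      (∀ v : ↥(insert 𝔭 (nPlusPlaces_finite (W := W) (p := p) (K := K) hK.1).toFinset),
        x v ∈ localKer κ.kerSubgroup ((W.baseChange K).geomPrimaryTorsion p)
          (v : HeightOneSpectrum (𝓞 K))) →
        ∃ c : (W.baseChange K).subgroupH1 p (⊤ : Subgroup (absoluteGaloisGroup K)),
          locAtFinset (W.baseChange K) p _ c = x ∧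
          ∀ v : HeightOneSpectrum (𝓞 K), ((p : ℕ) : 𝓞 K) ∉ v.asIdeal → v ∉ (∅ : Set _) →
            v ∉ insert 𝔭 (nPlusPlaces_finite (W := W) (p := p) (K := K) hK.1).toFinset →
              c ∈ awayKer ⊤ ((W.baseChange K).geomPrimaryTorsion p) v) :
    Finite (IwasawaDual.endInvariants (conjSelmerAc (W.baseChange K) p κ 𝔭 ∅ γ - 1)) ∧
      Finite ((W.baseChange K).resOfLe p (le_top : κ.kerSubgroup ≤ ⊤)).ker ∧
      Nat.card (IwasawaDual.endInvariants (conjSelmerAc (W.baseChange K) p κ 𝔭 ∅ γ - 1)) *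
          Nat.card ((W.baseChange K).resOfLe p (le_top : κ.kerSubgroup ≤ ⊤)).ker =
        Nat.card (selmerAcBase (W.baseChange K) p 𝔭 ∅) *
          (Nat.card (localKer κ.kerSubgroup ((W.baseChange K).geomPrimaryTorsion p) 𝔭) *
            ∏ v ∈ (nPlusPlaces_finite (W := W) (p := p) (K := K) hK.1).toFinset,
              Nat.card (localKer κ.kerSubgroup ((W.baseChange K).geomPrimaryTorsion p) v)) := by
  haveI : IsTotallyComplex K := hK.2
  haveI hEK : (W.baseChange K).IsElliptic := by rw [baseChange]; infer_instance
  set F := (nPlusPlaces_finite (W := W) (p := p) (K := K) hK.1).toFinset with hF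
  have h𝔭F : 𝔭 ∉ F := not_mem_nPlusPlaces_toFinset_of_mem hK h𝔭
  have hTp : ∀ v ∈ insert 𝔭 F, v ≠ 𝔭 → ((p : ℕ) : 𝓞 K) ∉ v.asIdeal := fun v hv hne ↦ by
    rcases Finset.mem_insert.mp hv with rfl | hvF
    · exact absurd rfl hne
    · exact ((mem_nPlusPlaces_iff v).mp
        ((nPlusPlaces_finite (W := W) (p := p) hK.1).mem_toFinset.mp hvF)).1
  have hS : ∀ c : (W.baseChange K).subgroupH1 p (⊤ : Subgroup (absoluteGaloisGroup K)),
      (W.baseChange K).resOfLe p (le_top : κ.kerSubgroup ≤ ⊤) c ∈ selmerAc (W.baseChange K) p κ 𝔭 ∅ →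
        ∀ v : HeightOneSpectrum (𝓞 K), ((p : ℕ) : 𝓞 K) ∉ v.asIdeal → v ∉ (∅ : Set _) →
          v ∉ insert 𝔭 F → c ∈ awayKer ⊤ ((W.baseChange K).geomPrimaryTorsion p) v := by
    intro c hc v hpv _ hvT
    have hvN : v ∉ nPlusPlaces W K p := fun h ↦
      hvT (Finset.mem_insert_of_mem ((nPlusPlaces_finite (W := W) (p := p) hK.1).mem_toFinset.mpr h))
    exact away_descent_of_splitBad_subset (W.baseChange K) p κ 𝔭 (nPlusPlaces W K p) hK.1 hκ
      (fun v hpv hbad he1 hf1 ↦ mem_nPlusPlaces_of v hpv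
        (primesEquiv_under_dvd_conductorNorm_of_not_hasGoodReductionAt K v hbad) he1 hf1)
      c (selmerAc_empty_le hc) v hpv hvN
  have hfinT : ∀ v ∈ insert 𝔭 F,
      Finite (localKer κ.kerSubgroup ((W.baseChange K).geomPrimaryTorsion p) v) := fun v hv ↦ by
    rcases Finset.mem_insert.mp hv with rfl | hvF
    · exact hfin𝔭
    · exact hfin v ((nPlusPlaces_finite (W := W) (p := p) hK.1).mem_toFinset.mp hvF)
  obtain ⟨h1, h2, h3⟩ := natCard_endInvariants_mul_natCard_resKer_eq (W := W.baseChange K)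
    (S := (∅ : Set (HeightOneSpectrum (𝓞 K)))) hγ.out (insert 𝔭 F) (Finset.mem_insert_self 𝔭 F)
    hTp (fun v _ ↦ Set.notMem_empty v) hS hfinT hloc
  refine ⟨h1, h2, ?_⟩
  rw [h3, Finset.prod_insert h𝔭F]

end Anticyclotomic

end Summit.BirchSwinnertonDyer.BirchSwinnertonDyer.Theorems.SchneiderFreeAdditiveX3

end
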